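import Mathlib
import Literature.NumberTheory.LFunctions.WeilGroundState
import Literature.NumberTheory.LFunctions.WeilGroundStateRealZerosProofs
import Summits.RiemannHypothesis.RiemannHypothesis.Theorems.WeilGroundStateGroundStateSimpleEvenStubIntertwineContinuity
import Summits.RiemannHypothesis.RiemannHypothesis.Theorems.WeilGroundStateGroundStateSimpleEvenStubIntertwineKernel
import HarnessLib

/-!
# Crux `GroundStateSimpleEven` (stmt-RiemannHypothesis-1526), line `parity-multiplicity-commutator`,
# stub INTERTWINE — helper 4: the form-Cauchy approximants of the EDGE derivative are minimising

Support file (`--supports stmt-RiemannHypothesis-1526`) for the stub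
`stub_oddMinimisers_of_edgeCancelledPair`.  Normalisation of
`Literature/NumberTheory/LFunctions/WeilExplicit.lean`: `W = weilFunctional`, `Q g = W(g ⋆ g̃)`,
`g̃ = weilReflect g`, `⋆ = weilConv`, `ε = ε(a) = weilGroundEnergy a`,
`q(f) = Re Q(f) − ε∫|f|² ≥ 0` on window test functions.

## Setting and contents (everything proved; Mathlib + proved tree files only)

Two ground states `u₁, u₂` at window `a`, scalars `c₁, c₂`, `H ∈ L²` vanishing a.e. off
`[-a, a]` with `∫ H = 0` and `c₂u₁ − c₁u₂ = ∫_{-a}^t H` a.e., and window test functions `hₙ → H`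
in `L²` (the data of `stub_evenPair_edgeCancellation`).

* `tendsto_weilFunctional_weilConv_approximants` (**the Euler–Lagrange equation passes to the
  derivative**): `W(hₙ ⋆ ψ̃) → ε ∫ H conj ψ` for every window test function `ψ`.  Mechanism:
  correct `hₙ` to mean zero (`∫ hₙ → ∫ H = 0`), take window primitives `Pₙ`
  (`Pₙ → c₂u₁ − c₁u₂` in `L²`), use the kernel identity `W(Pₙ' ⋆ ψ̃) = −W(Pₙ ⋆ (ψ')̃)`
  (continuum Connes–van Suijlekom Lemma 5.1, helper 2) and the weak Euler–Lagrange equation for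
  `c₂u₁ − c₁u₂` along `Pₙ` (helper 1), and `∫ (c₂u₁ − c₁u₂) conj ψ' = −∫ H conj ψ`.
* `tendsto_polarDefect_approximants`: the polar defect `q(hₙ + ψ) − q(hₙ) − q(ψ) → 0`.
* `tendsto_shiftedForm_approximants` (registered as `stub_intertwine_shiftedFormVanishes`): if
  moreover `Re Q(hₙ − hₘ) → 0` (form-Cauchy), then `q(hₙ) → 0`, by Cauchy–Schwarz for `q`
  (`ConnesVanSuijlekom.abs_polar_le`): `q(h_M) ≤ (q(hₙ + h_M) − q(hₙ) − q(h_M)) + 10 q(hₙ − h_M)`.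

No definitions, no named facts.
-/

noncomputable section

open Set MeasureTheory Filter Complex
open scoped Real Topology ComplexConjugate

namespace Summit.RiemannHypothesis.RiemannHypothesis.Theorems.GroundStateSimpleEven

open Literature.NumberTheory.LFunctions
open Summit.RiemannHypothesis.RiemannHypothesis.Theorems.GroundStatesConvergeToXi

-- `linter.dupNamespace` off: the mandated namespace `Summit.RiemannHypothesis.RiemannHypothesis.…`
-- (single-problem summit) repeats a component.
set_option linter.dupNamespace false

section Approximants

variable {a : ℝ} {u₁ u₂ H : ℝ → ℂ} {c₁ c₂ : ℂ} {h : ℕ → ℝ → ℂ}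

/-- A window test function with `∫ β = 1` (Mathlib's normalised smooth bump of outer radius
`a`). [folklore] -/
theorem exists_window_bump (ha : 0 < a) :
    ∃ β : ℝ → ℂ, IsWeilTest β ∧ tsupport β ⊆ Icc (-a) a ∧ ∫ t, β t = 1 := by
  let b : ContDiffBump (0 : ℝ) := ⟨a / 2, a, by positivity, by linarith⟩
  refine ⟨fun t ↦ ((b.normed volume t : ℝ) : ℂ),
    ⟨Complex.ofRealCLM.contDiff.comp b.contDiff_normed,
      b.hasCompactSupport_normed.comp_left Complex.ofReal_zero⟩, ?_, ?_⟩
  · refine (tsupport_comp_subset Complex.ofReal_zero _).trans ?_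
    rw [b.tsupport_normed_eq, Real.closedBall_eq_Icc, zero_sub, zero_add]
  · rw [integral_complex_ofReal, b.integral_normed, Complex.ofReal_one]

/-- **The Euler–Lagrange equation passes to the derivative.** In the setting of the module
docstring, for every window test function `ψ`: `W(hₙ ⋆ ψ̃) → ε(a) ∫ H conj ψ`.
(Continuum Connes–van Suijlekom 2025 Lemma 5.1/5.2: `d/dt` intertwines the Weil pairing, the
boundary term vanishing because `c₂u₁ − c₁u₂ = ∫_{-a}^t H` with `∫ H = 0`.) [folklore] -/
theorem tendsto_weilFunctional_weilConv_approximants (hu₁ : IsWeilGroundState a u₁)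
    (hu₂ : IsWeilGroundState a u₂) (hH : MemLp H 2)
    (hHz : ∀ᵐ t : ℝ, t ∉ Icc (-a) a → H t = 0) (hH0 : ∫ t, H t = 0)
    (hprim : ∀ᵐ t : ℝ, c₂ * u₁ t - c₁ * u₂ t = ∫ s in (-a)..t, H s)
    (hh : ∀ n, IsWeilTest (h n) ∧ tsupport (h n) ⊆ Icc (-a) a)
    (hL : Tendsto (fun n ↦ ∫ t, ‖h n t - H t‖ ^ 2) atTop (𝓝 0))
    {ψ : ℝ → ℂ} (hψ : IsWeilTest ψ) (hψs : tsupport ψ ⊆ Icc (-a) a) :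
    Tendsto (fun n ↦ weilFunctional (weilConv (h n) (weilReflect ψ))) atTop
      (𝓝 ((weilGroundEnergy a : ℂ) * ∫ t, H t * conj (ψ t))) := by
  have ha : 0 < a := hu₁.pos
  have hhm : ∀ n, MemLp (h n) 2 := fun n ↦ ConnesVanSuijlekom.isWeilTest_memLp (hh n).1
  have hhi : ∀ n, Integrable (h n) := fun n ↦
    (hh n).1.1.continuous.integrable_of_hasCompactSupport (hh n).1.2
  have hHi : Integrable H := integrable_of_memLp_two_window hH hHz
  have hz : ∀ n, ∀ᵐ t : ℝ, t ∉ Icc (-a) a → h n t - H t = 0 := fun n ↦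
    hHz.mono fun t ht hts ↦ by rw [ht hts, eq_zero_of_tsupport_subset (hh n).2 hts, sub_zero]
  -- (1) the means `mₙ = ∫ hₙ → ∫ H = 0`
  set m : ℕ → ℂ := fun n ↦ ∫ t, h n t with hm
  have hm0 : Tendsto m atTop (𝓝 0) := by
    refine squeeze_zero_norm (a := fun n ↦ √(2 * a) * √(∫ t, ‖h n t - H t‖ ^ 2))
      (fun n ↦ ?_) ?_
    · have e : m n = ∫ t, (h n t - H t) := by
        rw [integral_sub (hhi n) hHi, hH0, sub_zero]
      rw [e]
      exact norm_integral_le_sqrt_window ha.le ((hhm n).sub hH) (hz n)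
    · simpa using (hL.sqrt).const_mul (√(2 * a))
  -- (2) mean-zero correction `kₙ = hₙ − mₙ β`
  obtain ⟨β, hβ, hβs, hβ1⟩ := exists_window_bump ha
  have hβm : MemLp β 2 := ConnesVanSuijlekom.isWeilTest_memLp hβ
  have hβi : Integrable β := hβ.1.continuous.integrable_of_hasCompactSupport hβ.2
  set k : ℕ → ℝ → ℂ := fun n t ↦ h n t - m n * β t with hk
  have hkt : ∀ n, IsWeilTest (k n) ∧ tsupport (k n) ⊆ Icc (-a) a := fun n ↦
    ⟨(hh n).1.sub (hβ.const_mul (m n)),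
      tsupport_sub_subset_Icc (hh n).2 (tsupport_mul_subset_right.trans hβs)⟩
  have hkm : ∀ n, MemLp (k n) 2 := fun n ↦ ConnesVanSuijlekom.isWeilTest_memLp (hkt n).1
  have hki : ∀ n, Integrable (k n) := fun n ↦
    (hkt n).1.1.continuous.integrable_of_hasCompactSupport (hkt n).1.2
  have hk0 : ∀ n, ∫ t, k n t = 0 := fun n ↦ by
    simp only [hk]
    rw [integral_sub (hhi n) (hβi.const_mul _), integral_const_mul, hβ1, mul_one, sub_self]
  have hkz : ∀ n, ∀ᵐ t : ℝ, t ∉ Icc (-a) a → k n t - H t = 0 := fun n ↦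
    hHz.mono fun t ht hts ↦ by rw [ht hts, eq_zero_of_tsupport_subset (hkt n).2 hts, sub_zero]
  -- (3) `kₙ → H` in `L²`
  have hkL : Tendsto (fun n ↦ ∫ t, ‖k n t - H t‖ ^ 2) atTop (𝓝 0) := by
    have hb : ∀ n, √(∫ t, ‖k n t - H t‖ ^ 2) ≤
        √(∫ t, ‖h n t - H t‖ ^ 2) + ‖m n‖ * √(∫ t, ‖β t‖ ^ 2) := by
      intro n
      have h1 := sqrt_integral_norm_sq_sub_le ((hhm n).sub hH) (hβm.const_mul (m n))
      have e2 : ∫ t, ‖m n * β t‖ ^ 2 = ‖m n‖ ^ 2 * ∫ t, ‖β t‖ ^ 2 := by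
        simp only [norm_mul, mul_pow]
        rw [integral_const_mul]
      simp only [Pi.sub_apply] at h1
      rw [e2, Real.sqrt_mul (sq_nonneg _), Real.sqrt_sq (norm_nonneg _)] at h1
      have e1 : ∀ t, h n t - H t - m n * β t = k n t - H t := fun t ↦ by
        simp only [hk]
        ring
      simp_rw [e1] at h1
      exact h1
    have hlim : Tendsto (fun n ↦ √(∫ t, ‖h n t - H t‖ ^ 2) + ‖m n‖ * √(∫ t, ‖β t‖ ^ 2))
        atTop (𝓝 0) := by
      have h1 := hL.sqrt
      have h2 := (hm0.norm).mul_const (√(∫ t, ‖β t‖ ^ 2))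
      rw [Real.sqrt_zero] at h1
      rw [norm_zero, zero_mul] at h2
      simpa using h1.add h2
    have hsq := (squeeze_zero (fun n ↦ Real.sqrt_nonneg _) hb hlim).pow 2
    rw [zero_pow two_ne_zero] at hsq
    exact hsq.congr fun n ↦ Real.sq_sqrt (integral_nonneg fun _ ↦ by positivity)
  -- (4) window primitives `Pₙ` of `kₙ`; `Pₙ → c₂u₁ − c₁u₂` in `L²`
  have hP : ∀ n, ∃ v : ℝ → ℂ, IsWeilTest v ∧ tsupport v ⊆ Icc (-a) a ∧ deriv v = k n ∧
      ∀ t, v t = ∫ τ in (-a)..t, k n τ :=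
    fun n ↦ exists_windowPrimitive (hkt n).1 (hkt n).2 (hk0 n)
  choose P hPt hPs hPd hPi using hP
  have hPL : Tendsto (fun n ↦ ∫ t, ‖P n t - (c₂ * u₁ t - c₁ * u₂ t)‖ ^ 2) atTop (𝓝 0) := by
    have heq : ∀ n, ∫ t, ‖P n t - (c₂ * u₁ t - c₁ * u₂ t)‖ ^ 2 =
        ∫ t, ‖∫ s in (-a)..t, (k n s - H s)‖ ^ 2 := by
      intro n
      refine integral_congr_ae (hprim.mono fun t ht ↦ ?_)
      simp only
      rw [ht, hPi n t, ← intervalIntegral.integral_sub (hki n).intervalIntegrable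
        hHi.intervalIntegrable]
    simp_rw [heq]
    refine squeeze_zero (fun n ↦ integral_nonneg fun _ ↦ by positivity)
      (fun n ↦ integral_norm_sq_primitive_le ha ((hkm n).sub hH) (hkz n) ?_) ?_
    · rw [integral_sub (hki n) hHi, hk0 n, hH0, sub_zero]
    · simpa using hkL.const_mul (4 * a ^ 2)
  -- (5) Euler–Lagrange along `Pₙ` against the window test function `ψ'`
  have hψ' : IsWeilTest (deriv ψ) := hψ.deriv
  have hψ's : tsupport (deriv ψ) ⊆ Icc (-a) a := tsupport_deriv_subset.trans hψs
  have hEL := tendsto_weilFunctional_weilConv_of_tendsto_comb hu₁ hu₂ c₁ c₂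
    (fun n ↦ ⟨hPt n, hPs n⟩) hPL hψ' hψ's
  -- (6) `∫ (c₂u₁ − c₁u₂) conj ψ' = −∫ H conj ψ` (integration by parts in the limit)
  have hGm : MemLp (fun t ↦ c₂ * u₁ t - c₁ * u₂ t) 2 :=
    (hu₁.memLp.const_mul c₂).sub (hu₂.memLp.const_mul c₁)
  have hIBP : ∫ t, (c₂ * u₁ t - c₁ * u₂ t) * conj (deriv ψ t) = -∫ t, H t * conj (ψ t) := by
    have h1 : Tendsto (fun n ↦ ∫ t, P n t * conj (deriv ψ t)) atTop
        (𝓝 (∫ t, (c₂ * u₁ t - c₁ * u₂ t) * conj (deriv ψ t))) :=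
      ConnesVanSuijlekom.tendsto_integral_mul_conj_left (ConnesVanSuijlekom.isWeilTest_memLp hψ')
        hGm (fun n ↦ ConnesVanSuijlekom.isWeilTest_memLp (hPt n)) hPL
    have h2 : Tendsto (fun n ↦ ∫ t, k n t * conj (ψ t)) atTop (𝓝 (∫ t, H t * conj (ψ t))) :=
      ConnesVanSuijlekom.tendsto_integral_mul_conj_left (ConnesVanSuijlekom.isWeilTest_memLp hψ)
        hH hkm hkL
    have h3 : ∀ n, ∫ t, P n t * conj (deriv ψ t) = -∫ t, k n t * conj (ψ t) := fun n ↦ by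
      have h4 := integral_deriv_mul_conj (hPt n) hψ
      rw [hPd n] at h4
      linear_combination h4
    simp_rw [h3] at h1
    exact tendsto_nhds_unique h1 h2.neg
  -- (7) `W(kₙ ⋆ ψ̃) = −W(Pₙ ⋆ (ψ')̃) → −ε ∫ (c₂u₁ − c₁u₂) conj ψ' = ε ∫ H conj ψ`
  have hWk : Tendsto (fun n ↦ weilFunctional (weilConv (k n) (weilReflect ψ))) atTop
      (𝓝 ((weilGroundEnergy a : ℂ) * ∫ t, H t * conj (ψ t))) := by
    have h1 : ∀ n, weilFunctional (weilConv (k n) (weilReflect ψ)) =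
        -weilFunctional (weilConv (P n) (weilReflect (deriv ψ))) := fun n ↦ by
      rw [← hPd n]
      exact weilFunctional_weilConv_deriv_left (hPt n) hψ
    simp_rw [h1]
    have h2 := hEL.neg
    rw [hIBP] at h2
    convert h2 using 2
    ring
  -- (8) `W(hₙ ⋆ ψ̃) = W(kₙ ⋆ ψ̃) + mₙ W(β ⋆ ψ̃)`
  have hsplit : ∀ n, weilFunctional (weilConv (h n) (weilReflect ψ)) =
      weilFunctional (weilConv (k n) (weilReflect ψ)) +
        m n * weilFunctional (weilConv β (weilReflect ψ)) := fun n ↦ by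
    have e : k n = h n - fun t ↦ m n * β t := rfl
    rw [e, weilFunctional_weilConv_sub_left (hh n).1 (hβ.const_mul (m n)) hψ,
      weilFunctional_weilConv_const_mul_left]
    ring
  simp_rw [hsplit]
  simpa using hWk.add (hm0.mul_const (weilFunctional (weilConv β (weilReflect ψ))))

/-- **The polar defect of the approximants vanishes in the limit.** In the setting of the module
docstring, for every window test function `ψ`:
`q(hₙ + ψ) − q(hₙ) − q(ψ) = 2 Re W(hₙ ⋆ ψ̃) − 2ε Re⟨hₙ, ψ⟩ → 2ε Re⟨H, ψ⟩ − 2ε Re⟨H, ψ⟩ = 0`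
(hermitian symmetry `W(ψ ⋆ h̃) = conj W(h ⋆ ψ̃)`, `weilFunctional_weilConv_weilReflect_swap`). [folklore] -/
theorem tendsto_polarDefect_approximants (hu₁ : IsWeilGroundState a u₁)
    (hu₂ : IsWeilGroundState a u₂) (hH : MemLp H 2)
    (hHz : ∀ᵐ t : ℝ, t ∉ Icc (-a) a → H t = 0) (hH0 : ∫ t, H t = 0)
    (hprim : ∀ᵐ t : ℝ, c₂ * u₁ t - c₁ * u₂ t = ∫ s in (-a)..t, H s)
    (hh : ∀ n, IsWeilTest (h n) ∧ tsupport (h n) ⊆ Icc (-a) a)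
    (hL : Tendsto (fun n ↦ ∫ t, ‖h n t - H t‖ ^ 2) atTop (𝓝 0))
    {ψ : ℝ → ℂ} (hψ : IsWeilTest ψ) (hψs : tsupport ψ ⊆ Icc (-a) a) :
    Tendsto (fun n ↦ ((weilQuadratic (h n + ψ)).re -
        weilGroundEnergy a * ∫ x, ‖(h n + ψ) x‖ ^ 2) -
        ((weilQuadratic (h n)).re - weilGroundEnergy a * ∫ x, ‖h n x‖ ^ 2) -
        ((weilQuadratic ψ).re - weilGroundEnergy a * ∫ x, ‖ψ x‖ ^ 2)) atTop (𝓝 0) := by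
  set ε : ℝ := weilGroundEnergy a with hε
  have hhm : ∀ n, MemLp (h n) 2 := fun n ↦ ConnesVanSuijlekom.isWeilTest_memLp (hh n).1
  have hW := tendsto_weilFunctional_weilConv_approximants hu₁ hu₂ hH hHz hH0 hprim hh hL hψ hψs
  have hPair : Tendsto (fun n ↦ ∫ t, h n t * conj (ψ t)) atTop (𝓝 (∫ t, H t * conj (ψ t))) :=
    ConnesVanSuijlekom.tendsto_integral_mul_conj_left (ConnesVanSuijlekom.isWeilTest_memLp hψ)
      hH hhm hL
  have key : ∀ n, ((weilQuadratic (h n + ψ)).re - ε * ∫ x, ‖(h n + ψ) x‖ ^ 2) -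
      ((weilQuadratic (h n)).re - ε * ∫ x, ‖h n x‖ ^ 2) -
      ((weilQuadratic ψ).re - ε * ∫ x, ‖ψ x‖ ^ 2) =
      2 * (weilFunctional (weilConv (h n) (weilReflect ψ))).re -
        2 * (ε * (∫ t, h n t * conj (ψ t)).re) := by
    intro n
    have e1 := ConnesVanSuijlekom.re_weilQuadratic_add_real_mul (hh n).1 hψ 1
    have e2 := ConnesVanSuijlekom.integral_norm_sq_add_real_mul (hh n).1 hψ 1
    have hone : (h n + fun x ↦ ((1 : ℝ) : ℂ) * ψ x) = h n + ψ := by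
      funext x
      simp
    rw [hone] at e1 e2
    rw [e1, e2, weilFunctional_weilConv_weilReflect_swap (h n) ψ]
    simp only [Complex.add_re, Complex.conj_re]
    ring
  simp_rw [key]
  have h1 := ((Complex.continuous_re.tendsto _).comp hW).const_mul 2
  have h2 := (((Complex.continuous_re.tendsto _).comp hPair).const_mul ε).const_mul 2
  have h3 := h1.sub h2
  rw [Function.comp_def, Function.comp_def] at h3
  convert h3 using 2
  rw [Complex.re_ofReal_mul, sub_self]

/-- **The shifted forms of the approximants vanish: `q(hₙ) → 0`.** In the setting of the module
docstring, if moreover the approximants are form-Cauchy (`Re Q(hₙ − hₘ) < η` for `n, m ≥ N(η)`),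
then `Re Q(hₙ) − ε ∫|hₙ|² → 0`.  Proof: `d_{nM} = q(hₙ − h_M) → 0` as `n, M → ∞` (form-Cauchy and
`L²`-Cauchy); Cauchy–Schwarz for the non-negative form `q` (`ConnesVanSuijlekom.abs_polar_le`,
`shiftedForm_sub_le_add`, `q(2f) = 4q(f)`) gives
`q(h_M) ≤ (q(hₙ + h_M) − q(hₙ) − q(h_M)) + 10 d_{nM}`, and the polar defect tends to `0` as
`n → ∞` for fixed `M` (`tendsto_polarDefect_approximants`). [folklore] -/
theorem tendsto_shiftedForm_approximants (hu₁ : IsWeilGroundState a u₁)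
    (hu₂ : IsWeilGroundState a u₂) (hH : MemLp H 2)
    (hHz : ∀ᵐ t : ℝ, t ∉ Icc (-a) a → H t = 0) (hH0 : ∫ t, H t = 0)
    (hprim : ∀ᵐ t : ℝ, c₂ * u₁ t - c₁ * u₂ t = ∫ s in (-a)..t, H s)
    (hh : ∀ n, IsWeilTest (h n) ∧ tsupport (h n) ⊆ Icc (-a) a)
    (hL : Tendsto (fun n ↦ ∫ t, ‖h n t - H t‖ ^ 2) atTop (𝓝 0))
    (hC : ∀ η : ℝ, 0 < η → ∃ N : ℕ, ∀ n m : ℕ, N ≤ n → N ≤ m →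
      (weilQuadratic (h n - h m)).re < η) :
    Tendsto (fun n ↦ (weilQuadratic (h n)).re - weilGroundEnergy a * ∫ t, ‖h n t‖ ^ 2)
      atTop (𝓝 0) := by
  set ε : ℝ := weilGroundEnergy a with hε
  have hhm : ∀ n, MemLp (h n) 2 := fun n ↦ ConnesVanSuijlekom.isWeilTest_memLp (hh n).1
  set q : ℕ → ℝ := fun n ↦ (weilQuadratic (h n)).re - ε * ∫ t, ‖h n t‖ ^ 2 with hq
  have hsub : ∀ n M, IsWeilTest (h n - h M) ∧ tsupport (h n - h M) ⊆ Icc (-a) a := fun n M ↦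
    ⟨(hh n).1.sub (hh M).1, tsupport_sub_subset_Icc (hh n).2 (hh M).2⟩
  set d : ℕ → ℕ → ℝ := fun n M ↦
    (weilQuadratic (h n - h M)).re - ε * ∫ x, ‖(h n - h M) x‖ ^ 2 with hd
  have hq0 : ∀ n, 0 ≤ q n := fun n ↦ by
    have := ConnesVanSuijlekom.weilGroundEnergy_mul_le_re (hh n).1 (hh n).2
    simp only [hq]
    linarith
  have hd0 : ∀ n M, 0 ≤ d n M := fun n M ↦ by
    have := ConnesVanSuijlekom.weilGroundEnergy_mul_le_re (hsub n M).1 (hsub n M).2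
    simp only [hd]
    linarith
  -- (i) `d n M` is small for `n, M` large
  have hdsmall : ∀ δ : ℝ, 0 < δ → ∃ N : ℕ, ∀ n M : ℕ, N ≤ n → N ≤ M → d n M < δ := by
    intro δ hδ
    obtain ⟨N₁, hN₁⟩ := hC (δ / 2) (by positivity)
    obtain ⟨N₂, hN₂⟩ := eventually_atTop.1
      (hL.eventually (gt_mem_nhds (by positivity : (0 : ℝ) < δ / (8 * (|ε| + 1)))))
    refine ⟨max N₁ N₂, fun n M hn hM ↦ ?_⟩
    have h1 := hN₁ n M (le_of_max_le_left hn) (le_of_max_le_left hM)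
    have h2 : ∫ x, ‖(h n - h M) x‖ ^ 2 ≤
        2 * (∫ t, ‖h n t - H t‖ ^ 2) + 2 * ∫ t, ‖h M t - H t‖ ^ 2 := by
      simpa only [Pi.sub_apply] using integral_norm_sq_sub_le_two_mul (hhm n) (hhm M) hH
    have h3 := hN₂ n (le_of_max_le_right hn)
    have h4 := hN₂ M (le_of_max_le_right hM)
    have hI0 : 0 ≤ ∫ x, ‖(h n - h M) x‖ ^ 2 := integral_nonneg fun _ ↦ by positivity
    have h5 : -(ε * ∫ x, ‖(h n - h M) x‖ ^ 2) ≤ |ε| * ∫ x, ‖(h n - h M) x‖ ^ 2 := by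
      have := neg_abs_le ε
      nlinarith
    have h6 : |ε| * ∫ x, ‖(h n - h M) x‖ ^ 2 ≤ |ε| * (4 * (δ / (8 * (|ε| + 1)))) :=
      mul_le_mul_of_nonneg_left (by linarith) (abs_nonneg ε)
    have h7 : |ε| * (4 * (δ / (8 * (|ε| + 1)))) ≤ δ / 2 := by
      rw [show |ε| * (4 * (δ / (8 * (|ε| + 1)))) = (δ / 2) * (|ε| / (|ε| + 1)) by
        field_simp
        ring]
      have : |ε| / (|ε| + 1) ≤ 1 := (div_le_one (by positivity)).2 (by linarith)
      nlinarith
    simp only [hd]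
    linarith
  -- (ii) `q M ≤ D n M + 10 d n M`, `D` the polar defect of `(hₙ, h_M)`
  set D : ℕ → ℕ → ℝ := fun n M ↦ ((weilQuadratic (h n + h M)).re -
    ε * ∫ x, ‖(h n + h M) x‖ ^ 2) - q n - q M with hD
  have hineq : ∀ n M, q M ≤ D n M + 10 * d n M := by
    intro n M
    have hA := ConnesVanSuijlekom.abs_polar_le (hh M).1 (hh M).2 (hsub n M).1 (hsub n M).2
    rw [add_sub_cancel (h M) (h n)] at hA
    have h2t : IsWeilTest (fun x ↦ (2 : ℂ) * h M x) := (hh M).1.const_mul 2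
    have h2s : tsupport (fun x ↦ (2 : ℂ) * h M x) ⊆ Icc (-a) a :=
      tsupport_mul_subset_right.trans (hh M).2
    have hB := ConnesVanSuijlekom.shiftedForm_sub_le_add h2t h2s (hsub n M).1 (hsub n M).2
    have e2 : ((fun x ↦ (2 : ℂ) * h M x) + (h n - h M)) = h n + h M := by
      funext x
      simp only [Pi.add_apply, Pi.sub_apply]
      ring
    rw [e2] at hB
    have e3 : (weilQuadratic fun x ↦ (2 : ℂ) * h M x).re - ε * ∫ x, ‖(2 : ℂ) * h M x‖ ^ 2 =
        4 * q M := by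
      rw [weilQuadratic_const_mul, show (2 : ℂ) = ((2 : ℝ) : ℂ) by norm_num, Complex.normSq_ofReal,
        Complex.re_ofReal_mul]
      simp only [norm_mul, mul_pow, Complex.norm_real, Real.norm_eq_abs]
      rw [integral_const_mul]
      simp only [hq]
      norm_num
      ring
    have e4 : √(4 * q M) = 2 * √(q M) := by
      rw [Real.sqrt_mul (by norm_num), show √(4 : ℝ) = 2 by
        rw [show (4 : ℝ) = 2 ^ 2 by norm_num, Real.sqrt_sq zero_le_two]]
    rw [e3, e4] at hB
    have hamgm : 6 * (√(q M) * √(d n M)) ≤ q M + 9 * d n M := by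
      nlinarith [sq_nonneg (√(q M) - 3 * √(d n M)), Real.sq_sqrt (hq0 M), Real.sq_sqrt (hd0 n M)]
    have hA' := (abs_le.1 hA).2
    simp only [hD, hq, hd] at hA' hB hamgm ⊢
    nlinarith [hA', hB, hamgm, Real.sqrt_nonneg ((weilQuadratic (h M)).re - ε * ∫ t, ‖h M t‖ ^ 2),
      Real.sqrt_nonneg ((weilQuadratic (h n - h M)).re - ε * ∫ x, ‖(h n - h M) x‖ ^ 2)]
  -- (iii) conclusion
  rw [Metric.tendsto_atTop]
  intro δ hδ
  obtain ⟨N, hN⟩ := hdsmall (δ / 20) (by positivity)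
  refine ⟨N, fun M hM ↦ ?_⟩
  have hDlim : Tendsto (fun n ↦ D n M) atTop (𝓝 0) :=
    tendsto_polarDefect_approximants hu₁ hu₂ hH hHz hH0 hprim hh hL (hh M).1 (hh M).2
  have hev : ∀ᶠ n in atTop, q M ≤ D n M + δ / 2 := eventually_atTop.2 ⟨N, fun n hn ↦ by
    have h1 := hineq n M
    have h2 := hN n M hn hM
    linarith⟩
  have hle : q M ≤ 0 + δ / 2 := ge_of_tendsto (hDlim.add_const (δ / 2)) hev
  change dist (q M) 0 < δ
  rw [Real.dist_eq, sub_zero, abs_of_nonneg (hq0 M)]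
  linarith

end Approximants

end Summit.RiemannHypothesis.RiemannHypothesis.Theorems.GroundStateSimpleEven

namespace Summit.RiemannHypothesis.RiemannHypothesis.Theorems

open Literature.NumberTheory.LFunctions

set_option linter.dupNamespace false in
/-- **Registered sub-goal of stub INTERTWINE (helper 4): the form-Cauchy approximants of the EDGE
derivative are minimising.** With the data of `stub_evenPair_edgeCancellation` (ground states
`u₁, u₂`, `H ∈ L²` on the window with `∫ H = 0`, `c₂u₁ − c₁u₂ = ∫_{-a}^t H` a.e., window test
functions `hₙ → H` in `L²` with `Re Q(hₙ − hₘ) → 0`): `Re Q(hₙ) − ε(a) ∫|hₙ|² → 0`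
(`GroundStateSimpleEven.tendsto_shiftedForm_approximants`). [folklore] -/
theorem stub_intertwine_shiftedFormVanishes :
    ∀ a : ℝ, 0 < a → ∀ u₁ u₂ : ℝ → ℂ, IsWeilGroundState a u₁ → IsWeilGroundState a u₂ →
      ∀ c₁ c₂ : ℂ, ∀ H : ℝ → ℂ, MemLp H 2 →
        (∀ᵐ t : ℝ, t ∉ Icc (-a) a → H t = 0) → ∫ t, H t = 0 →
        (∀ᵐ t : ℝ, c₂ * u₁ t - c₁ * u₂ t = ∫ s in (-a)..t, H s) →
        ∀ h : ℕ → ℝ → ℂ, (∀ n, IsWeilTest (h n) ∧ tsupport (h n) ⊆ Icc (-a) a) →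
          Tendsto (fun n => ∫ t, ‖h n t - H t‖ ^ 2) atTop (𝓝 0) →
          (∀ η : ℝ, 0 < η → ∃ N : ℕ, ∀ n m : ℕ, N ≤ n → N ≤ m →
            (weilQuadratic (h n - h m)).re < η) →
          Tendsto (fun n => (weilQuadratic (h n)).re - weilGroundEnergy a * ∫ t, ‖h n t‖ ^ 2)
            atTop (𝓝 0) :=
  fun _ _ _ _ hu₁ hu₂ _ _ _ hH hHz hH0 hprim _ hh hL hC =>
    GroundStateSimpleEven.tendsto_shiftedForm_approximants hu₁ hu₂ hH hHz hH0 hprim hh hL hC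

end Summit.RiemannHypothesis.RiemannHypothesis.Theorems

end
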